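import Mathlib
import HarnessLib
import Literature.Analysis.FluidPDE.ParabolicComparison

/-!
# Item `LrcModEntire` (stmt-NavierStokesRegularity-20428), CLASS road to `stub_twistingTHGerm` — the relocated wall (Ô-BOUND) of the (OSC)
# road is implied by PARABOLIC PROXIMITY of the plane extremizers of `v₂` (a slope-free bound on the oscillation of the Clebsch weight)

Cell ns-regularity-ideate, LEAD ns-poloidal-K2-p3 g13 (`--supports stmt-NavierStokesRegularity-20428`; memo OSC-LIOUVILLE-g13 §5 (h1), crux dir).

THE POINT.  On a (TH) plane `{y₂ = c}` with slope `μ` (`∂₂V_b = μ ∂_b V₂`, `b = 0,1`) the Clebsch weight is `W = (1−μ)V₂` (up to a constant on the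
plane), and the (OSC) road needs `√(−t)·osc_plane W` bounded toward the past — a priori hopeless because nothing bounds the slope `1 − μ`.  But
`μ·(V₂(y) − V₂(y′)) = μ∫_{y′}^{y} ∇ₕV₂·dl = ∫_{y′}^{y} ∂₂V_h·dl`, so for ANY two points of the plane
    `|(1 − μ)(V₂(y) − V₂(y′))| ≤ |V₂(y) − V₂(y′)| + 2K·‖y − y′‖`,   `K := sup_plane |∂₂V_h|`,
with NO `μ` on the right (`weight_osc_le_of_planeShear`).  Reading for a class profile (Type-I: `|V₂| ≤ N(−t)^{−1/2}`, `|∂₂V_h| ≤ C₁(−t)^{−1}`): with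
`x⁺, x⁻` a plane arg-max / arg-min of `v₂` at distance `d`, `Ô = √(−t)·osc_plane W ≤ 2N + 2C₁·d/√(−t)` — so the wall (Ô-BOUND) of the class road is
implied by (h1′) «on every plane, the extremizers of v₂ lie within parabolic distance O(√(−t)) of each other toward the past» (a statement about v₂
alone; sufficient, not necessary).  Pure calculus (mean value inequality along the segment); no Navier–Stokes input.

WHAT THIS IS NOT: not a claim about Navier–Stokes regularity and not the stub — a kinematic inequality on one (TH) plane (bears_on LADDER-NS N0, item
20428 / crux 19708; both OPEN).
-/

noncomputable section

-- the summit and its single sub-problem share the name (CONVENTIONS §1), as in every Theorems file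
set_option linter.dupNamespace false

namespace Summit.NavierStokesRegularity.NavierStokesRegularity.Theorems.PoloidalWindowDoorLrcModEntireTwistingTHPlaneOscillationProximity

open Set Filter Topology
open Literature.Analysis.FluidPDE

variable {V : EuclideanSpace ℝ (Fin 3) → EuclideanSpace ℝ (Fin 3)} {μ c K : ℝ}

/-- A direction between two points of one horizontal plane is horizontal: its height component vanishes. -/
theorem sub_apply_two_eq_zero {y y' : EuclideanSpace ℝ (Fin 3)} (hy : y 2 = c) (hy' : y' 2 = c) : (y - y') 2 = 0 := by
  simp [hy, hy']

/-- Splitting a directional derivative of the height component over the coordinate frame: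
`(DV(x)u)₂ = Σ_b u_b (∂_b V)₂`. -/
theorem fderiv_apply_two_eq_sum (x u : EuclideanSpace ℝ (Fin 3)) :
    fderiv ℝ V x u 2 = ∑ b : Fin 3, u b * fderiv ℝ V x (EuclideanSpace.single b 1) 2 := by
  conv_lhs => rw [← (EuclideanSpace.basisFun (Fin 3) ℝ).sum_repr u]
  simp [map_sum, map_smul, Finset.sum_apply]

/-- **The slope-free bound on the weight oscillation.**  Let `V` be differentiable, let the plane `{y₂ = c}` be proportional-shear with slope
`μ` (`(∂₂V)_b = μ (∂_bV)₂` on the plane, `b = 0, 1`) and let `|(∂₂V)₀|, |(∂₂V)₁| ≤ K` on the plane.  Then for any two points `y, y′` of the plane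
`|μ (V₂(y) − V₂(y′))| ≤ 2K‖y − y′‖`, hence `|(1 − μ)(V₂(y) − V₂(y′))| ≤ |V₂(y) − V₂(y′)| + 2K‖y − y′‖`. -/
theorem mul_osc_le_of_planeShear (hV : Differentiable ℝ V)
    (hslope : ∀ y : EuclideanSpace ℝ (Fin 3), y 2 = c → ∀ b : Fin 3, b ≠ 2 →
      fderiv ℝ V y (EuclideanSpace.single 2 1) b = μ * fderiv ℝ V y (EuclideanSpace.single b 1) 2)
    (hK : ∀ y : EuclideanSpace ℝ (Fin 3), y 2 = c → ∀ b : Fin 3, b ≠ 2 → |fderiv ℝ V y (EuclideanSpace.single 2 1) b| ≤ K)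
    {y y' : EuclideanSpace ℝ (Fin 3)} (hy : y 2 = c) (hy' : y' 2 = c) :
    |μ * (V y 2 - V y' 2)| ≤ 2 * K * ‖y - y'‖ := by
  set e : EuclideanSpace ℝ (Fin 3) := y - y' with he
  -- the segment `σ ↦ y' + σ e` stays in the plane
  have hplane : ∀ σ : ℝ, (y' + σ • e) 2 = c := by
    intro σ
    have h2 : e 2 = 0 := by rw [he]; exact sub_apply_two_eq_zero hy hy'
    simp [h2, hy']
  -- `g(σ) = μ V₂(y' + σ e)` and its derivative
  set g : ℝ → ℝ := fun σ => μ * V (y' + σ • e) 2 with hg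
  have hV2 : Differentiable ℝ fun x : EuclideanSpace ℝ (Fin 3) => V x 2 :=
    fun x => (EuclideanSpace.proj (𝕜 := ℝ) (2 : Fin 3)).differentiableAt.comp x (hV x)
  have hfd2 : ∀ x u : EuclideanSpace ℝ (Fin 3), fderiv ℝ (fun x => V x 2) x u = fderiv ℝ V x u 2 := by
    intro x u
    have h := (EuclideanSpace.proj (𝕜 := ℝ) (2 : Fin 3)).hasFDerivAt.comp x (hV x).hasFDerivAt
    rw [show (fun x => V x 2) = (EuclideanSpace.proj (𝕜 := ℝ) (2 : Fin 3)) ∘ V from rfl, h.fderiv]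
    simp
  have hgd : ∀ σ : ℝ, HasDerivAt g (μ * fderiv ℝ V (y' + σ • e) e 2) σ := by
    intro σ
    have h := (hasDerivAt_comp_line hV2 y' e σ).const_mul μ
    rw [hfd2] at h
    exact h
  -- bound on `g′`: `(DV e)₂ = Σ_b e_b (∂_bV)₂`, `e₂ = 0`, and `μ(∂_bV)₂ = (∂₂V)_b` is bounded by `K`
  have hKnn : 0 ≤ K := (abs_nonneg _).trans (hK y hy 0 (by decide))
  have hbound : ∀ σ : ℝ, |μ * fderiv ℝ V (y' + σ • e) e 2| ≤ 2 * K * ‖e‖ := by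
    intro σ
    set x := y' + σ • e with hx
    have hx2 : x 2 = c := hplane σ
    rw [fderiv_apply_two_eq_sum x e, Fin.sum_univ_three]
    have he2 : e 2 = 0 := by rw [he]; exact sub_apply_two_eq_zero hy hy'
    rw [he2, zero_mul, add_zero, mul_add]
    have h0 := hslope x hx2 0 (by decide)
    have h1 := hslope x hx2 1 (by decide)
    have k0 := hK x hx2 0 (by decide)
    have k1 := hK x hx2 1 (by decide)
    have e0 : μ * (e 0 * fderiv ℝ V x (EuclideanSpace.single 0 1) 2) = e 0 * fderiv ℝ V x (EuclideanSpace.single 2 1) 0 := by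
      rw [h0]; ring
    have e1 : μ * (e 1 * fderiv ℝ V x (EuclideanSpace.single 1 1) 2) = e 1 * fderiv ℝ V x (EuclideanSpace.single 2 1) 1 := by
      rw [h1]; ring
    rw [e0, e1]
    have hc0 : |e 0| ≤ ‖e‖ := by
      have h := PiLp.norm_apply_le e 0
      rwa [Real.norm_eq_abs] at h
    have hc1 : |e 1| ≤ ‖e‖ := by
      have h := PiLp.norm_apply_le e 1
      rwa [Real.norm_eq_abs] at h
    calc |e 0 * fderiv ℝ V x (EuclideanSpace.single 2 1) 0 + e 1 * fderiv ℝ V x (EuclideanSpace.single 2 1) 1|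
        ≤ |e 0 * fderiv ℝ V x (EuclideanSpace.single 2 1) 0| + |e 1 * fderiv ℝ V x (EuclideanSpace.single 2 1) 1| := abs_add_le _ _
      _ = |e 0| * |fderiv ℝ V x (EuclideanSpace.single 2 1) 0| + |e 1| * |fderiv ℝ V x (EuclideanSpace.single 2 1) 1| := by
          rw [abs_mul, abs_mul]
      _ ≤ ‖e‖ * K + ‖e‖ * K := add_le_add (mul_le_mul hc0 k0 (abs_nonneg _) (norm_nonneg _))
          (mul_le_mul hc1 k1 (abs_nonneg _) (norm_nonneg _))
      _ = 2 * K * ‖e‖ := by ring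
  -- mean value inequality on `[0,1]`
  have hmvt := norm_image_sub_le_of_norm_deriv_le_segment_01' (f := g)
    (fun σ _ => (hgd σ).hasDerivWithinAt) (fun σ _ => by rw [Real.norm_eq_abs]; exact hbound σ)
  have hg1 : g 1 = μ * V y 2 := by simp [hg, he]
  have hg0 : g 0 = μ * V y' 2 := by simp [hg]
  rw [hg1, hg0, Real.norm_eq_abs] at hmvt
  have e2 : μ * V y 2 - μ * V y' 2 = μ * (V y 2 - V y' 2) := by ring
  rw [e2] at hmvt
  simpa [he] using hmvt

/-- **Corollary (the (OSC) road's wall in slope-free form).**  Under the hypotheses of `mul_osc_le_of_planeShear`, the oscillation of the Clebsch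
weight `W = (1−μ)V₂` between two points of the plane is bounded WITHOUT the slope:
`|(1 − μ)(V₂(y) − V₂(y′))| ≤ |V₂(y) − V₂(y′)| + 2K‖y − y′‖`. -/
theorem weight_osc_le_of_planeShear (hV : Differentiable ℝ V)
    (hslope : ∀ y : EuclideanSpace ℝ (Fin 3), y 2 = c → ∀ b : Fin 3, b ≠ 2 →
      fderiv ℝ V y (EuclideanSpace.single 2 1) b = μ * fderiv ℝ V y (EuclideanSpace.single b 1) 2)
    (hK : ∀ y : EuclideanSpace ℝ (Fin 3), y 2 = c → ∀ b : Fin 3, b ≠ 2 → |fderiv ℝ V y (EuclideanSpace.single 2 1) b| ≤ K)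
    {y y' : EuclideanSpace ℝ (Fin 3)} (hy : y 2 = c) (hy' : y' 2 = c) :
    |(1 - μ) * (V y 2 - V y' 2)| ≤ |V y 2 - V y' 2| + 2 * K * ‖y - y'‖ := by
  have h := mul_osc_le_of_planeShear hV hslope hK hy hy'
  have e : (1 - μ) * (V y 2 - V y' 2) = (V y 2 - V y' 2) - μ * (V y 2 - V y' 2) := by ring
  rw [e]
  exact (abs_sub _ _).trans (by linarith)

end Summit.NavierStokesRegularity.NavierStokesRegularity.Theorems.PoloidalWindowDoorLrcModEntireTwistingTHPlaneOscillationProximity
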